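import Summits.QuantumFields.YangMills.Theorems.AllWindowsColdBoxBulkMidSandwichSubGaussian

/-!
# LINEAR VARIANCE PINCHING under the sandwich (first-order Brascamp–Lieb ceiling + Cramér–Rao floor)
# (crux idea `logconcave-core-extension` on ⟨stmt-QuantumFields-24006⟩, piece P5′ with the GLOBAL constant)

`linearVariance_pinching` (whitened frame, `A ∈ C²`, `0 ≤ δ < 1`): for every `b`,
`|b|²Z²/(1+δ) ≤ (∫(x·b)²e^{−A})·Z − (∫(x·b)e^{−A})² ≤ |b|²Z²/(1−δ)`,  `Z = ∫e^{−A}`,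
i.e. `(1+δ)⁻¹ ≤ Var_A(x·b)/|b|² ≤ (1−δ)⁻¹` — NO centring hypothesis (variance is shift-invariant).  Ceiling = the
tree's PROVED Brascamp–Lieb (`bl_linear_tilt` at tilt `0`); floor = the affine-dual inequality `affine_dual_ineq`
(Cramér–Rao) with the constant field `b/(1+δ)` and the constant `c` = the Gibbs mean.  The card's P5′ asks the same
with the LOCAL constant `r_K` on the core (available from `Literature…bl_wholeSpace_raw`'s pointwise inverse Hessian;
not done here).

HONEST SCOPE.  Free-hands work of the LEAD seat of ⟨stmt-QuantumFields-24006⟩ (FCL lineage) on an ingredient of an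
UN-TRIAGED crux idea card; classical log-concave probability.  No stub of LINE-18, no crux, rung or summit is proved; the
Yang–Mills mass gap is NOT proved by any of this.
-/

noncomputable section

namespace Summit.QuantumFields.YangMills.Theorems.SandwichVariancePinching

open MeasureTheory Real Filter Topology Set

variable {n : ℕ}

/-- **LINEAR VARIANCE PINCHING** (whitened frame, `A ∈ C²`, `0 ≤ δ < 1`, no centring):
`|b|²Z²/(1+δ) ≤ (∫(x·b)²e^{−A})Z − (∫(x·b)e^{−A})² ≤ |b|²Z²/(1−δ)`. [folklore: Brascamp–Lieb 1976 Thm 4.1 / Cramér–Rao] -/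
theorem linearVariance_pinching {A : (Fin n → ℝ) → ℝ} (hA : ContDiff ℝ 2 A) {δ : ℝ} (hδ : 0 ≤ δ)
    (hδ1 : δ < 1)
    (hsw : ∀ x h : Fin n → ℝ, (1 - δ) * (h ⬝ᵥ h) ≤ A (x + h) + A (x - h) - 2 * A x ∧
      A (x + h) + A (x - h) - 2 * A x ≤ (1 + δ) * (h ⬝ᵥ h)) (b : Fin n → ℝ) :
    (b ⬝ᵥ b) / (1 + δ) * (∫ x, exp (-A x)) ^ 2 ≤
        (∫ x, (x ⬝ᵥ b) ^ 2 * exp (-A x)) * (∫ x, exp (-A x)) - (∫ x, (x ⬝ᵥ b) * exp (-A x)) ^ 2 ∧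
      (∫ x, (x ⬝ᵥ b) ^ 2 * exp (-A x)) * (∫ x, exp (-A x)) - (∫ x, (x ⬝ᵥ b) * exp (-A x)) ^ 2 ≤
        (b ⬝ᵥ b) / (1 - δ) * (∫ x, exp (-A x)) ^ 2 := by
  have hAc : Continuous A := hA.continuous
  constructor
  · -- FLOOR (Cramér–Rao via the affine-dual inequality with the constant field `b/(1+δ)`)
    have h1δ : 0 < 1 + δ := by linarith
    set a : ℝ := 1 / (1 + δ) with ha
    set Z : ℝ := ∫ x, exp (-A x) with hZ
    set M : ℝ := ∫ x, (x ⬝ᵥ b) * exp (-A x) with hM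
    set I₂ : ℝ := ∫ x, (x ⬝ᵥ b) ^ 2 * exp (-A x) with hI₂
    have hZpos : 0 < Z := by
      have hi := integrable_tilt hAc hδ1 hsw b 0 continuous_const (w := fun _ => (1:ℝ)) (D := 1) (k := 0)
        (by norm_num) (fun x => by simp)
      rw [hZ]
      refine integral_exp_pos ?_
      simpa using hi
    -- the observable `F = x·b`
    have hF : ContDiff ℝ 1 (fun x : Fin n → ℝ => x ⬝ᵥ b) := by
      have e : (fun x : Fin n → ℝ => x ⬝ᵥ b) = fun x => ∑ i, x i * b i := by funext x; rfl
      rw [e]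
      exact ContDiff.sum fun i _ => (contDiff_apply ℝ ℝ i).mul contDiff_const
    have hfd : ∀ x : Fin n → ℝ, ∀ v, fderiv ℝ (fun y : Fin n → ℝ => y ⬝ᵥ b) x v = v ⬝ᵥ b := by
      intro x v
      obtain ⟨Lx, hLx, hLxv⟩ :=
        Literature.MathematicalPhysics.QuantumFieldTheory.Balaban1983to89.B14.Eq328GaussianIBP.hasFDerivAt_dotProduct_const
          b x
      rw [hLx.fderiv, hLxv]
    have key := affine_dual_ineq hA hδ hδ1 hsw 0 (a • b) hF (DF := ∑ i, |b i|) (DF' := ∑ i, |b i|)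
      (fun x => growth_mono (by norm_num : 1 ≤ 3) (abs_dotProduct_const_le b) x)
      (fun x j => by
        rw [hfd]
        have h1 : |(Pi.single j (1:ℝ) : Fin n → ℝ) ⬝ᵥ b| = |b j| := by simp [dotProduct, Pi.single_apply]
        rw [h1]
        have h2 : |b j| ≤ ∑ i, |b i| := Finset.single_le_sum (fun i _ => abs_nonneg (b i)) (Finset.mem_univ j)
        have h3 : (1:ℝ) ≤ (1 + ‖x‖) ^ 2 := one_le_pow₀ (by linarith [norm_nonneg x])
        nlinarith [Finset.sum_nonneg (fun i (_ : i ∈ Finset.univ) => abs_nonneg (b i))])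
      (M / Z)
    simp only [Matrix.zero_mulVec, zero_add, hfd, Matrix.trace_zero, zero_mul, sub_zero,
      smul_dotProduct, dotProduct_smul, smul_eq_mul, integral_const_mul] at key
    -- `key : 2 (a |b|² Z) − (1+δ) (a (a |b|²) Z) ≤ ∫ (x·b − M/Z)² e^{−A}`
    -- expand the right-hand side
    have hI0 : Integrable fun x => exp (-A x) := by
      have := integrable_tilt hAc hδ1 hsw b 0 continuous_const (w := fun _ => (1:ℝ)) (D := 1) (k := 0)
        (by norm_num) (fun x => by simp)
      simpa using this
    have hI1 : Integrable fun x => (x ⬝ᵥ b) * exp (-A x) := by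
      have := integrable_tilt hAc hδ1 hsw b 0 (continuous_id.dotProduct continuous_const)
        (w := fun x => x ⬝ᵥ b) (k := 1) (by norm_num) (abs_dotProduct_const_le b)
      simpa using this
    have hI2i : Integrable fun x => (x ⬝ᵥ b) ^ 2 * exp (-A x) := by
      have hb2 : ∀ x : Fin n → ℝ, |(x ⬝ᵥ b) ^ 2| ≤ (∑ i, |b i|) * (∑ i, |b i|) * (1 + ‖x‖) ^ (1 + 1) := by
        intro x
        have := abs_mul_le_growth (abs_dotProduct_const_le b) (abs_dotProduct_const_le b) x
        simpa [sq] using this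
      have := integrable_tilt hAc hδ1 hsw b 0 ((continuous_id.dotProduct continuous_const).pow 2)
        (w := fun x => (x ⬝ᵥ b) ^ 2) (k := 2) (by norm_num) hb2
      simpa using this
    have hexp : (∫ x, (x ⬝ᵥ b - M / Z) ^ 2 * exp (-A x)) = I₂ - 2 * (M / Z) * M + (M / Z) ^ 2 * Z := by
      have e : (fun x => (x ⬝ᵥ b - M / Z) ^ 2 * exp (-A x)) = fun x =>
          (x ⬝ᵥ b) ^ 2 * exp (-A x) - 2 * (M / Z) * ((x ⬝ᵥ b) * exp (-A x)) + (M / Z) ^ 2 * exp (-A x) := by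
        funext x; ring
      have hI12 : Integrable fun x => (x ⬝ᵥ b) ^ 2 * exp (-A x) - 2 * (M / Z) * ((x ⬝ᵥ b) * exp (-A x)) :=
        hI2i.sub (hI1.const_mul _)
      rw [e, integral_add hI12 (hI0.const_mul _), integral_sub hI2i (hI1.const_mul _), integral_const_mul,
        integral_const_mul]
    rw [hexp] at key
    -- conclude: multiply by `Z > 0`
    have e1 : 2 * (a * (b ⬝ᵥ b) * Z) - (1 + δ) * (a * (a * (b ⬝ᵥ b)) * Z) = (b ⬝ᵥ b) / (1 + δ) * Z := by
      rw [ha]; field_simp; ring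
    rw [e1] at key
    have e2 : (I₂ - 2 * (M / Z) * M + (M / Z) ^ 2 * Z) * Z = I₂ * Z - M ^ 2 := by
      field_simp; ring
    have h := mul_le_mul_of_nonneg_right key hZpos.le
    rw [e2] at h
    calc (b ⬝ᵥ b) / (1 + δ) * Z ^ 2 = (b ⬝ᵥ b) / (1 + δ) * Z * Z := by ring
      _ ≤ I₂ * Z - M ^ 2 := h
  · -- CEILING (Brascamp–Lieb at tilt `0`)
    have h := bl_linear_tilt hA hδ1 hsw b 0
    simp only [zero_mul, zero_sub] at h
    calc (∫ x, (x ⬝ᵥ b) ^ 2 * exp (-A x)) * (∫ x, exp (-A x)) - (∫ x, (x ⬝ᵥ b) * exp (-A x)) ^ 2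
        ≤ (1 - δ)⁻¹ * (b ⬝ᵥ b) * (∫ x, exp (-A x)) ^ 2 := h
      _ = (b ⬝ᵥ b) / (1 - δ) * (∫ x, exp (-A x)) ^ 2 := by rw [div_eq_inv_mul]

end Summit.QuantumFields.YangMills.Theorems.SandwichVariancePinching

end
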